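import Summits.PneNP.PneNP.Theses.EcdlpDefinability
import Summits.PneNP.PneNP.Theorems.EcdlpDefinabilityEcdlpInNP
import Literature.Computability.Cryptography.EcdlpLanguage
import Literature.Computability.Complexity.ClayProblem
import Literature.Computability.Complexity.CircuitClassesUniformProofs
import Literature.Computability.Complexity.ProbabilisticClassesProofs

/-!
# BC2(c) probes, part B — re-languagings and stronger pieces

Census companion (crux `EcdlpNotInP` = X, stmt-PneNP-2071; S = `PneNP`). Same probe shape as part A; self-contained:
the section `Local` re-declares VERBATIM the census's re-languagings (`StrategyCensus.EcdlpSearchInFP`,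
`…EcdlpHalfLanguage`, `…EcdlpMembershipLanguage`) and its one-inclusion lemmas (`…_of_not_mem_PPoly`, `…_of_not_mem_BPP`).
Pieces: X_search := `¬ EcdlpSearchInFP` (least-log search function ∉ FP), X_half := `EcdlpHalfLanguage ∉ P`
(Blum–Micali half predicate), X_mem := `EcdlpMembershipLanguage ∉ P` (the t = ∞ slice), X_ppoly := `L_EC ∉ P/poly`,
X_bpp := `L_EC ∉ BPP`.
EXPECTED: sorries at B1–B6 (the re-languagings are ⟺ / ≥ X IN TRUTH but only via Turing-machine constructions, so the
cheap probe cannot see it — recorded so that nobody reads "probe failed" as "piece below X"); no sorry at B7–B10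
(stronger pieces closed onto S and X by one landed inclusion each).
-/

set_option linter.dupNamespace false
set_option linter.unusedVariables false
set_option linter.unusedTactic false
set_option linter.unreachableTactic false

namespace Summit.PneNP.PneNP.Cruxes.EcdlpNotInP.ProbesB

open Literature.Computability.Complexity Literature.Computability.Cryptography
open Summit.PneNP.PneNP.Theses.EcdlpDefinability

namespace Local

/-- = `StrategyCensus.pneNP_of_ecdlpNotInP`. [cite: CookClay2006, §1] -/
theorem pneNP_of_ecdlpNotInP (hX : EcdlpNotInP) : _root_.PneNP :=
  closes Summit.PneNP.PneNP.Theorems.ecdlpDefinability_ecdlpInNP_proof hX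

/-- = `StrategyCensus.ecdlpNotInP_of_not_mem_PPoly`. [cite: AroraBarak2009, §6.1] -/
theorem ecdlpNotInP_of_not_mem_PPoly (h : EcdlpLanguage ∉ PPoly) : EcdlpNotInP := by
  change EcdlpLanguage ∉ PNPWave0.P Bool
  rw [show PNPWave0.P Bool = Classes.P from P_bool_eq_holds]
  exact fun hP => h (P_subset_PPoly_holds hP)

/-- = `StrategyCensus.pneNP_of_not_mem_PPoly`. [cite: AroraBarak2009, §6.1] -/
theorem pneNP_of_not_mem_PPoly (h : EcdlpLanguage ∉ PPoly) : _root_.PneNP :=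
  pneNP_of_ecdlpNotInP (ecdlpNotInP_of_not_mem_PPoly h)

/-- = `StrategyCensus.ecdlpNotInP_of_not_mem_BPP`. [cite: AroraBarak2009, §7.1] -/
theorem ecdlpNotInP_of_not_mem_BPP (h : EcdlpLanguage ∉ BPP) : EcdlpNotInP := by
  change EcdlpLanguage ∉ PNPWave0.P Bool
  rw [show PNPWave0.P Bool = Classes.P from P_bool_eq_holds]
  exact fun hP => h (P_subset_BPP_holds hP)

/-- = `StrategyCensus.pneNP_of_not_mem_BPP`. [cite: AroraBarak2009, §7.1] -/
theorem pneNP_of_not_mem_BPP (h : EcdlpLanguage ∉ BPP) : _root_.PneNP :=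
  pneNP_of_ecdlpNotInP (ecdlpNotInP_of_not_mem_BPP h)

/-- = `StrategyCensus.EcdlpSearchInFP`. [cite: Miller1986ECC, pp. 421–423] -/
def EcdlpSearchInFP : Prop :=
  ∃ f ∈ FP, ∀ p a₁ a₂ a₃ a₄ a₆ xp yp xq yq t : ℕ, EcdlpSolvable p a₁ a₂ a₃ a₄ a₆ xp yp xq yq t →
    ∃ m : ℕ, f (encodingListNatBool.encode [p, a₁, a₂, a₃, a₄, a₆, xp, yp, xq, yq]) =
        encodingListNatBool.encode [m] ∧ m ≤ t ∧ EcdlpSolvable p a₁ a₂ a₃ a₄ a₆ xp yp xq yq m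

/-- = `StrategyCensus.EcdlpHalfLanguage`. [cite: BlumMicali1984, §3] -/
def EcdlpHalfLanguage : Language Bool :=
  encodingListNatBool.toLanguage {l : List ℕ | ∃ p a₁ a₂ a₃ a₄ a₆ xp yp xq yq : ℕ,
    l = [p, a₁, a₂, a₃, a₄, a₆, xp, yp, xq, yq] ∧
      ∃ m : ℕ, EcdlpSolvable p a₁ a₂ a₃ a₄ a₆ xp yp xq yq m ∧
        (∀ m' : ℕ, m' < m → ¬ EcdlpSolvable p a₁ a₂ a₃ a₄ a₆ xp yp xq yq m') ∧
        ∃ hp : p.Prime, (haveI : Fact p.Prime := ⟨hp⟩;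
          ∃ hP : (ecdlpCurve p a₁ a₂ a₃ a₄ a₆).toAffine.Nonsingular (xp : ZMod p) (yp : ZMod p),
            2 * m < addOrderOf (WeierstrassCurve.Affine.Point.some (xp : ZMod p) (yp : ZMod p) hP))}

/-- = `StrategyCensus.EcdlpMembershipLanguage`. [cite: SilvermanAEC2009, Example XI.4.1(c)] -/
def EcdlpMembershipLanguage : Language Bool :=
  encodingListNatBool.toLanguage {l : List ℕ | ∃ p a₁ a₂ a₃ a₄ a₆ xp yp xq yq : ℕ,
    l = [p, a₁, a₂, a₃, a₄, a₆, xp, yp, xq, yq] ∧ ∃ t : ℕ, EcdlpSolvable p a₁ a₂ a₃ a₄ a₆ xp yp xq yq t}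

end Local

open Local

/-- X_search -/ def X_search : Prop := ¬ EcdlpSearchInFP
/-- X_half -/ def X_half : Prop := EcdlpHalfLanguage ∉ PNPWave0.P Bool
/-- X_mem -/ def X_mem : Prop := EcdlpMembershipLanguage ∉ PNPWave0.P Bool
/-- X_ppoly -/ def X_ppoly : Prop := EcdlpLanguage ∉ PPoly
/-- X_bpp -/ def X_bpp : Prop := EcdlpLanguage ∉ BPP

-- B1  X_search → S
set_option maxHeartbeats 400000 in
example : X_search → _root_.PneNP := by
  first | exact? | simpa [X_search] | (unfold X_search; simpa) | (aesop (config := { terminal := true })) | sorry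
-- B2  X_search → X
set_option maxHeartbeats 400000 in
example : X_search → EcdlpNotInP := by
  first | exact? | simpa [X_search] | (unfold X_search; simpa) | (aesop (config := { terminal := true })) | sorry
-- B3  X_half → S
set_option maxHeartbeats 400000 in
example : X_half → _root_.PneNP := by
  first | exact? | simpa [X_half] | (unfold X_half; simpa) | (aesop (config := { terminal := true })) | sorry
-- B4  X_half → X
set_option maxHeartbeats 400000 in
example : X_half → EcdlpNotInP := by
  first | exact? | simpa [X_half] | (unfold X_half; simpa) | (aesop (config := { terminal := true })) | sorry
-- B5  X_mem → S
set_option maxHeartbeats 400000 in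
example : X_mem → _root_.PneNP := by
  first | exact? | simpa [X_mem] | (unfold X_mem; simpa) | (aesop (config := { terminal := true })) | sorry
-- B6  X_mem → X
set_option maxHeartbeats 400000 in
example : X_mem → EcdlpNotInP := by
  first | exact? | simpa [X_mem] | (unfold X_mem; simpa) | (aesop (config := { terminal := true })) | sorry
-- B7  X_ppoly → S (expected: closed by name)
set_option maxHeartbeats 400000 in
example : X_ppoly → _root_.PneNP := by
  first | exact? | simpa [X_ppoly] | (unfold X_ppoly; exact?) | (aesop (config := { terminal := true })) | sorry
-- B8  X_ppoly → X (expected: closed by name)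
set_option maxHeartbeats 400000 in
example : X_ppoly → EcdlpNotInP := by
  first | exact? | simpa [X_ppoly] | (unfold X_ppoly; exact?) | (aesop (config := { terminal := true })) | sorry
-- B9  X_bpp → S (expected: closed by name)
set_option maxHeartbeats 400000 in
example : X_bpp → _root_.PneNP := by
  first | exact? | simpa [X_bpp] | (unfold X_bpp; exact?) | (aesop (config := { terminal := true })) | sorry
-- B10 X_bpp → X (expected: closed by name)
set_option maxHeartbeats 400000 in
example : X_bpp → EcdlpNotInP := by
  first | exact? | simpa [X_bpp] | (unfold X_bpp; exact?) | (aesop (config := { terminal := true })) | sorry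

end Summit.PneNP.PneNP.Cruxes.EcdlpNotInP.ProbesB
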